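import Literature.NumberTheory.GaloisCohomology.Howard2004.InertLocalPairingOfLiftsProofs
import Literature.NumberTheory.GaloisCohomology.Howard2004.ChebotarevInertPrimesProofs
import Literature.NumberTheory.GaloisRepresentations.DecompositionGroupRelSlim
import Literature.NumberTheory.GaloisRepresentations.ConjugationDescent
import HarnessLib

/-!
# Howard 2004, §1.3: the local transport `H¹(K_{v̄}, T) ≅ H¹(K_v, Tw T)` of a conjugation datum does NOT
# depend on the datum — every datum is the canonical one `ofLifts` up to an inner automorphism (proofs file)

Topic `NumberTheory/GaloisCohomology/Howard2004` (sequel to `SelmerTriples` — `ConjugationDatum`, `transportH1` —,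
`ConjugationDatumOfLifts` — the canonical datum `ofLifts σ … τ …` with the tree's adapted lifts —, and the generic
`GaloisRepresentations/ConjugationDescent` — «inner automorphisms act trivially on `H¹`», Serre, *Corps locaux* VII §5
Prop. 3 — and `DecompositionGroupCommTerminal` / `DecompositionGroupRelSlim` — `C_{Γ_K}(D_𝔓) = D_𝔓`, `D_𝔓 = res Γ_{K_v}`,
`res` injective).  THEOREMS ONLY: no definition, no named fact, no instance, no notation, no `sorry`.

SOURCE / WHY.  B. Howard, *The Heegner point Kolyvagin system*, Compositio Math. **140** (2004) = arXiv:1202.6340, §1.3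
(p. 7 L44–48): «conjugation by `τ` induces an isomorphism `H^i(K_v̄, T) ≅ H^i(K_v, Tw(T))`».  The tree's
`ConjugationDatum` (`SelmerTriples` §B) records this as data: at every finite `v` a continuous bijective
`φ_v : Γ_{K_v} → Γ_{K_{σv}}` and an inner correction `δ_v ∈ Γ_K` with `res(φ_v g) = δ_v⁻¹ (τ⁻¹ res(g) τ) δ_v`
(`compat`), and `transportH1 := H¹(φ_v, ρ(δ_v))`.  The cell's (GD-LINE-S) residual letter `hGQ` («the `G_ℚ`-invariant local
Tate pairing», Lemma 1.5.3) is proved for the canonical datum `ofLifts` (`InertLocalPairingOfLiftsProofs`, seat w5 g8)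
and kept as a binder for a general datum (`ResidualLocalPairingLettersProofs.residual_horth`, x10b-p2 g15; closure
ledger §4 (c)).  THIS FILE removes the dependence on the datum: any two pairs `(φ_v, δ_v)`, `(φ'_v, δ'_v)` compatible
with the same `τ` differ by an inner automorphism of `Γ_{K_{σv}}` — because `δ_v⁻¹ δ'_v` normalises the decomposition
group `D_{𝔓_{σv}} = res Γ_{K_{σv}}`, which is its own commensurator ([NSW] 12.1.3, Mochizuki Thm. 1.1.1 (i)) — and inner
automorphisms act trivially on `H¹` (Serre); hence `transportH1` of every datum IS `transportH1` of `ofLifts`.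

WHAT IS PROVED (for every number field `K`, every `cd : ConjugationDatum K`, every finite place `v`):
* §1 `ConjugationDatum.sigma_mul_sigma_eq_one` (`σ² = 1`); **`exists_φ_eq_conj_of_compat`** — for ANY continuous
  surjective `φ' : Γ_{K_v} → Γ_{K_{σv}}` and `δ' ∈ Γ_K` with `res(φ' g) = δ'⁻¹ (cd.conj (res g)) δ'`:
  `∃ g₀ ∈ Γ_{K_{σv}}, (∀ x, cd.φ v x = g₀⁻¹ (φ' x) g₀) ∧ cd.δ v = δ' · res g₀`.
* §2 **`transportH1_eq_of_compat`** — for the same `(φ', δ')`, `H¹(cd.φ v, ρ(cd.δ v)) = H¹(φ', ρ(δ'))` on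
  `H¹(K_{σv}, T)` (`ConjugationDescent.map_eq_map_of_inner_one`); **`transportH1_eq_transportH1_ofLifts`** —
  `cd.transportH1 ρ v = (ofLifts cd.σ _ _ cd.τ cd.isLift cd.involutive).transportH1 ρ v` (same types definitionally:
  `ofLifts` has the same `σ`, `τ`, `isLift`, hence the same `conj` and `twist`).
* §3 `ConjugationDatum.muSemilinearMap_τ_eq_neg` — «`τ` inverts `μ_n`» for the `τ` of EVERY conjugation datum (the
  tree's Artin–Schreier consequence `apply_eq_inv_of_isLiftOfAut_of_pow_eq_one`: an involutive lift of a non-trivial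
  automorphism of a number field is a complex conjugation) — the letter `hτμ` discharged; and the application
  **`DualityDatum.inv_cohomologyMap_cupProduct_thetaH1_transportH1`** — the `G_ℚ`-compatibility of the residual local
  cup product (w5 g8's `…_ofLifts` headline = the letter `hGQ` of `InertLocalPairingInvarianceProofs` /
  `EigenSelmerDichotomyProofs.localCup_transportH1_cast_eq_zero_of_eq_of_eq_neg_of_readings` /
  `ResidualLocalPairingLettersProofs.residual_horth`) for EVERY conjugation datum, every residual duality datum `D̄`
  with H.5(c)-letter `hθ`, every reading `(λ, exp)` and every `σ`-compatible family of invariants (`IsConjCompatible`,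
  a kernel theorem for the canonical family): `inv_v (H²(exp λ)(τ_v x ∪_P τ_v y)) = inv_{σ v} (H²(exp λ)(x ∪_P y))`,
  `τ_v := θ_* ∘ transport_v` — by §2 and the retyping of `D̄`, `A` over `ofLifts` (field by field, definitional).

Cell `pub/bsd-print-x9`, G87 = Howard Thm. 1.6.1 (print leaf `thm161_dvrKolyvaginBound`, `stub_h161` of
stmt-BirchSwinnertonDyer-22642); seat `bsd-line-x10b-p1` LEAD g13, brick (HGQ-GEN).  HONEST FRAMING:
`thm161_dvrKolyvaginBound` is NOT proved; no summit statement is proved; the Birch–Swinnerton-Dyer conjecture is not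
proved by any of this.

References: [Howard2004HeegnerKolyvagin] §1.3 (arXiv p. 7 L33–48), Rem. 1.3.2, Lemma 1.5.3; [SerreLocalFields1979]
VII §5 Prop. 3; [NeukirchSchmidtWingberg2008] Cor. 12.1.3; [MochizukiAbsAnab2004] Thm. 1.1.1 (i); [NeukirchANT1999]
II §9 (9.6); [CasselsFrohlichANT1967] Ch. VI §1.1 (functoriality of `inv`).
-/

set_option autoImplicit false

noncomputable section

open Function NumberField IsDedekindDomain Field CategoryTheory
open scoped NumberField Pointwise

namespace Literature.NumberTheory.GaloisCohomology.Howard2004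

open Literature.NumberTheory.GaloisRepresentations
open Literature.NumberTheory.GaloisRepresentations.DiscreteGaloisModule
open Literature.NumberTheory.EllipticCurves

namespace ConjugationDatum

variable {K : Type} [Field K] [NumberField K]

/-! ## §1 Two compatible pairs differ by an inner automorphism of `Γ_{K_{σv}}` -/

/-- **`σ² = 1`** for the automorphism of a conjugation datum (`τ` is an involution of `K̄` lifting `σ`; the tree's
`ofLifts` asks for this equation). [cite: Howard2004HeegnerKolyvagin, §1.3 (arXiv:1202.6340 p. 7 L33–41)] -/
theorem sigma_mul_sigma_eq_one (cd : ConjugationDatum K) : cd.σ * cd.σ = 1 := by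
  refine AlgEquiv.ext fun x => ?_
  apply (algebraMap K (AlgebraicClosure K)).injective
  change algebraMap K (AlgebraicClosure K) (cd.σ (cd.σ x)) = algebraMap K (AlgebraicClosure K) x
  rw [← cd.isLift, ← cd.isLift, cd.involutive]

/-- Normaliser ≤ commensurator: an element `w` with `w H w⁻¹ = H` lies in the commensurator of `H`. [folklore] -/
private theorem mem_commensurator_of_conjAct_smul_eq {G : Type*} [Group G] (H : Subgroup G) (w : G)
    (h : ConjAct.toConjAct w • H = H) : w ∈ Subgroup.Commensurable.commensurator H := by
  rw [Subgroup.Commensurable.commensurator_mem_iff, h]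

/-- **Two compatible pairs at `v` differ by an inner automorphism of `Γ_{K_{σv}}`.**  For a conjugation datum `cd`
and ANY pair `(φ', δ')` — `φ' : Γ_{K_v} → Γ_{K_{σv}}` continuous and onto, `δ' ∈ Γ_K` — satisfying the same
compatibility `res(φ' g) = δ'⁻¹ · cd.conj(res g) · δ'` as `(cd.φ v, cd.δ v)`: there is `g₀ ∈ Γ_{K_{σv}}` with
`cd.φ v = g₀⁻¹ · φ' · g₀` and `cd.δ v = δ' · res(g₀)`.  PROOF: `w := δ_v⁻¹ δ'` conjugates
`res(φ'(Γ_{K_v})) = D_{𝔓_{σv}}` onto `res(φ_v(Γ_{K_v})) = D_{𝔓_{σv}}`, so `w ∈ N(D) ⊆ Comm(D) = D`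
(`commensurator_decompositionSubgroup_adicCompletionPrime`, [NSW] 12.1.3), `D = res Γ_{K_{σv}}`
(`decompositionSubgroup_adicCompletionPrime_eq_range`), `w = res g₁`, `g₀ := g₁⁻¹`; the conjugation formula by
injectivity of `res` (`absGaloisRestrict_adicCompletion_injective`).
[cite: Howard2004HeegnerKolyvagin, §1.3 (arXiv:1202.6340 p. 7 L44–48)] [cite: NeukirchSchmidtWingberg2008, Cor. 12.1.3] -/
theorem exists_φ_eq_conj_of_compat (cd : ConjugationDatum K) (v : HeightOneSpectrum (𝓞 K))
    (φ' : absoluteGaloisGroup (v.adicCompletion K) →ₜ* absoluteGaloisGroup ((cd.σ • v).adicCompletion K))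
    (hφ' : Function.Surjective φ') (δ' : absoluteGaloisGroup K)
    (compat' : ∀ g : absoluteGaloisGroup (v.adicCompletion K),
      absGaloisRestrict K ((cd.σ • v).adicCompletion K) (φ' g) =
        δ'⁻¹ * cd.conj (absGaloisRestrict K (v.adicCompletion K) g) * δ') :
    ∃ g₀ : absoluteGaloisGroup ((cd.σ • v).adicCompletion K),
      (∀ x, cd.φ v x = g₀⁻¹ * φ' x * g₀) ∧
        cd.δ v = δ' * absGaloisRestrict K ((cd.σ • v).adicCompletion K) g₀ := by
  -- notation (local, no definitions): `D`, `w`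
  set D := (adicCompletionPrime K (cd.σ • v)).decompositionSubgroup (absoluteGaloisGroup K) with hD
  have hDr : D = (absGaloisRestrict K ((cd.σ • v).adicCompletion K)).toMonoidHom.range :=
    decompositionSubgroup_adicCompletionPrime_eq_range K (cd.σ • v)
  set w : absoluteGaloisGroup K := (cd.δ v)⁻¹ * δ' with hw
  -- the two compatibilities give `w (res (φ' x)) w⁻¹ = res (cd.φ v x)` and `w⁻¹ (res (cd.φ v x)) w = res (φ' x)`
  have hconj : ∀ x, w * absGaloisRestrict K ((cd.σ • v).adicCompletion K) (φ' x) * w⁻¹ =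
      absGaloisRestrict K ((cd.σ • v).adicCompletion K) (cd.φ v x) := fun x => by
    rw [cd.compat v x, compat' x, hw]; group
  have hconj' : ∀ x, w⁻¹ * absGaloisRestrict K ((cd.σ • v).adicCompletion K) (cd.φ v x) * w =
      absGaloisRestrict K ((cd.σ • v).adicCompletion K) (φ' x) := fun x => by
    rw [cd.compat v x, compat' x, hw]; group
  have hφD : ∀ x, absGaloisRestrict K ((cd.σ • v).adicCompletion K) (cd.φ v x) ∈ D := fun x => by
    rw [hDr]; exact ⟨cd.φ v x, rfl⟩
  have hφ'D : ∀ x, absGaloisRestrict K ((cd.σ • v).adicCompletion K) (φ' x) ∈ D := fun x => by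
    rw [hDr]; exact ⟨φ' x, rfl⟩
  -- `w D w⁻¹ ⊆ D` (through `φ'` onto) and `w⁻¹ D w ⊆ D` (through `φ_v` onto)
  have hA : ∀ d ∈ D, w * d * w⁻¹ ∈ D := fun d hd => by
    rw [hDr] at hd
    obtain ⟨y, rfl⟩ := hd
    obtain ⟨x₁, rfl⟩ := hφ' y
    change w * absGaloisRestrict K ((cd.σ • v).adicCompletion K) (φ' x₁) * w⁻¹ ∈ D
    rw [hconj x₁]
    exact hφD x₁
  have hB : ∀ d ∈ D, w⁻¹ * d * w ∈ D := fun d hd => by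
    rw [hDr] at hd
    obtain ⟨y, rfl⟩ := hd
    obtain ⟨x, rfl⟩ := (cd.φ_bijective v).2 y
    change w⁻¹ * absGaloisRestrict K ((cd.σ • v).adicCompletion K) (cd.φ v x) * w ∈ D
    rw [hconj' x]
    exact hφ'D x
  -- `w D w⁻¹ = D`
  have hwD : ConjAct.toConjAct w • D = D := by
    refine le_antisymm (fun d hd => ?_) (fun d hd => ?_)
    · obtain ⟨s, hs, rfl⟩ := (Subgroup.mem_smul_pointwise_iff_exists d (ConjAct.toConjAct w) D).mp hd
      rw [ConjAct.toConjAct_smul]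
      exact hA s hs
    · have hd' : d = ConjAct.toConjAct w • (w⁻¹ * d * w) := by rw [ConjAct.toConjAct_smul]; group
      rw [hd']
      exact Subgroup.smul_mem_pointwise_smul _ _ _ (hB d hd)
  -- `w ∈ Comm(D) = D = res Γ_{K_{σv}}`
  have hwmem : w ∈ D := by
    rw [hD, ← commensurator_decompositionSubgroup_adicCompletionPrime K (cd.σ • v)]
    exact mem_commensurator_of_conjAct_smul_eq _ w hwD
  rw [hDr] at hwmem
  obtain ⟨g₁, hg₁⟩ := hwmem
  change absGaloisRestrict K ((cd.σ • v).adicCompletion K) g₁ = w at hg₁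
  refine ⟨g₁⁻¹, fun x => ?_, ?_⟩
  · apply absGaloisRestrict_adicCompletion_injective K (cd.σ • v)
    rw [inv_inv, map_mul, map_mul, map_inv, hg₁, hconj x]
  · rw [map_inv, hg₁, hw, mul_inv_rev, inv_inv, mul_inv_cancel_left]

/-! ## §2 The transport on `H¹` does not depend on the datum -/

/-- **`H¹(φ_v, ρ(δ_v))` depends only on `τ`**: for any pair `(φ', δ')` compatible with `cd.conj` as in §1 (`φ'`
continuous and onto), the map `H¹(K_{σv}, T) → H¹(K_v, Tw T)` induced by `(cd.φ v, ρ(cd.δ v))` equals the one induced by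
`(φ', ρ(δ'))` — inner automorphisms act trivially on `H¹` (`ConjugationDescent.map_eq_map_of_inner_one` with
`θ = cd.φ v = g₀⁻¹ φ' g₀`, `f₁ = ρ(cd.δ v) = ρ(δ') ∘ ρ(res g₀)`).
[cite: Howard2004HeegnerKolyvagin, §1.3 (arXiv:1202.6340 p. 7 L44–48)] [cite: SerreLocalFields1979, VII §5 Prop. 3] -/
theorem transportH1_eq_of_compat {M : Type} [AddCommGroup M] [TopologicalSpace M] [DiscreteTopology M]
    (cd : ConjugationDatum K) (ρ : DiscreteGaloisModule K M) (v : HeightOneSpectrum (𝓞 K))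
    (φ' : absoluteGaloisGroup (v.adicCompletion K) →ₜ* absoluteGaloisGroup ((cd.σ • v).adicCompletion K))
    (hφ' : Function.Surjective φ') (δ' : absoluteGaloisGroup K)
    (compat' : ∀ g : absoluteGaloisGroup (v.adicCompletion K),
      absGaloisRestrict K ((cd.σ • v).adicCompletion K) (φ' g) =
        δ'⁻¹ * cd.conj (absGaloisRestrict K (v.adicCompletion K) g) * δ')
    (f' : TopRep.res (φ' : absoluteGaloisGroup (v.adicCompletion K) →*
        absoluteGaloisGroup ((cd.σ • v).adicCompletion K))
        (DiscreteGaloisModule.toTopRep (ρ.toLocal (Sum.inr (cd.σ • v)))) ⟶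
      DiscreteGaloisModule.toTopRep ((cd.twist ρ).toLocal (Sum.inr v)))
    (hf' : ∀ m : M, f'.hom m = ρ δ' m) (x : galoisCohomology (ρ.toLocal (Sum.inr (cd.σ • v))) 1) :
    cd.transportH1 ρ v x = ContinuousCohomology.map φ' f' 1 x := by
  obtain ⟨g₀, hφ, hδ⟩ := cd.exists_φ_eq_conj_of_compat v φ' hφ' δ' compat'
  change ContinuousCohomology.map (cd.φ v) (cd.transportHom ρ v) 1 x = ContinuousCohomology.map φ' f' 1 x
  refine map_eq_map_of_inner_one g₀ φ' (cd.φ v) hφ (cd.transportHom ρ v) f' (fun m => ?_) x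
  change ρ (cd.δ v) m = f'.hom (ρ (absGaloisRestrict K ((cd.σ • v).adicCompletion K) g₀) m)
  rw [hf', hδ, map_mul, Module.End.mul_apply]

/-- **The transport of every conjugation datum IS the transport of the canonical datum `ofLifts`** with the same
`σ`, `τ` (Howard: «conjugation by `τ` induces an isomorphism `H¹(K_v̄, T) ≅ H¹(K_v, Tw(T))`» — the choice of the local
transport and of the inner correction is immaterial on cohomology).  Both sides have the same type definitionally
(`ofLifts` carries the same `σ`, `τ`, `isLift`).
[cite: Howard2004HeegnerKolyvagin, §1.3 and Rem. 1.3.2 (arXiv:1202.6340 p. 7 L44–48, p. 8 L13–17)] [cite: SerreLocalFields1979, VII §5 Prop. 3] -/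
theorem transportH1_eq_transportH1_ofLifts {M : Type} [AddCommGroup M] [TopologicalSpace M] [DiscreteTopology M]
    (cd : ConjugationDatum K) (ρ : DiscreteGaloisModule K M) (v : HeightOneSpectrum (𝓞 K)) :
    cd.transportH1 ρ v =
      (ofLifts cd.σ cd.σ_ne_one cd.sigma_mul_sigma_eq_one cd.τ cd.isLift cd.involutive).transportH1 ρ v := by
  refine AddMonoidHom.ext fun x => ?_
  exact cd.transportH1_eq_of_compat ρ v
    ((ofLifts cd.σ cd.σ_ne_one cd.sigma_mul_sigma_eq_one cd.τ cd.isLift cd.involutive).φ v)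
    (((ofLifts cd.σ cd.σ_ne_one cd.sigma_mul_sigma_eq_one cd.τ cd.isLift cd.involutive).φ_bijective v).2)
    ((ofLifts cd.σ cd.σ_ne_one cd.sigma_mul_sigma_eq_one cd.τ cd.isLift cd.involutive).δ v)
    ((ofLifts cd.σ cd.σ_ne_one cd.sigma_mul_sigma_eq_one cd.τ cd.isLift cd.involutive).compat v)
    ((ofLifts cd.σ cd.σ_ne_one cd.sigma_mul_sigma_eq_one cd.τ cd.isLift cd.involutive).transportHom ρ v)
    (fun _ => rfl) x

/-- Pointwise form of `transportH1_eq_transportH1_ofLifts`.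
[cite: Howard2004HeegnerKolyvagin, §1.3 (arXiv:1202.6340 p. 7 L44–48)] -/
theorem transportH1_apply_eq_ofLifts {M : Type} [AddCommGroup M] [TopologicalSpace M] [DiscreteTopology M]
    (cd : ConjugationDatum K) (ρ : DiscreteGaloisModule K M) (v : HeightOneSpectrum (𝓞 K))
    (x : galoisCohomology (ρ.toLocal (Sum.inr (cd.σ • v))) 1) :
    cd.transportH1 ρ v x =
      (ofLifts cd.σ cd.σ_ne_one cd.sigma_mul_sigma_eq_one cd.τ cd.isLift cd.involutive).transportH1 ρ v x :=
  DFunLike.congr_fun (cd.transportH1_eq_transportH1_ofLifts ρ v) x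


/-! ## §3 «`τ` inverts `μ`» for every datum, and the `G_ℚ`-compatibility of the residual local cup product -/

/-- **The `τ` of EVERY conjugation datum inverts the roots of unity of `K̄`** (`n ≠ 0`):
`muSemilinearMap cd.τ n ζ = -ζ` (additive notation for `τ ζ = ζ⁻¹`) — the letter `hτμ` of `InertLocalPairingOfLiftsProofs`
DISCHARGED: an involutive lift of the non-trivial automorphism `σ` is a complex conjugation (the tree's Artin–Schreier
consequence `apply_eq_inv_of_isLiftOfAut_of_pow_eq_one`).
[cite: Howard2004HeegnerKolyvagin, §1.3 (arXiv:1202.6340 p. 7 L33–41: «`τ` a fixed complex conjugation») and H.4 (p. 7 L69–73: `R(1)`)] -/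
theorem muSemilinearMap_τ_eq_neg (cd : ConjugationDatum K) {n : ℕ} (hn : n ≠ 0) (ζ : MuCarrier K n) :
    muSemilinearMap cd.τ n ζ = -ζ := by
  apply MuCarrier.eq_of_coe_eq
  rw [coe_muSemilinearMap, map_neg, toMul_neg, Subgroup.coe_inv, Units.val_inv_eq_inv_val]
  refine apply_eq_inv_of_isLiftOfAut_of_pow_eq_one cd.σ_ne_one cd.isLift cd.involutive hn ?_
  have h := ((MuCarrier.toAdditive ζ).toMul).2
  rw [mem_rootsOfUnity] at h
  rw [← Units.val_pow_eq_pow_val, h, Units.val_one]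

end ConjugationDatum

namespace DualityDatum

variable {K : Type} [Field K] [NumberField K] {Nbar : Type} [AddCommGroup Nbar]
  [TopologicalSpace Nbar] [DiscreteTopology Nbar] {R : Type} [CommRing R] [TopologicalSpace R]
  [DiscreteTopology R] [Module R Nbar] {p : ℕ} [Fact p.Prime] [Algebra ℤ_[p] R]
  {cd : ConjugationDatum K} {ρbar : DiscreteGaloisModule K Nbar}
  (Dbar : DualityDatum p cd ρbar R) (A : ResidualTau (R := R) cd ρbar) {k : ℕ}
  (lam : R →+ ZMod (p ^ k))
  (hlam : ∀ (z : ℤ_[p]) (r : R), lam (algebraMap ℤ_[p] R z * r) = PadicInt.toZModPow k z * lam r)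
  (exp : ZMod (p ^ k) →+ MuCarrier K (p ^ k))
  (hexp : ∀ (g : absoluteGaloisGroup K) (x : ZMod (p ^ k)),
    exp (cyclotomicCharacterModPow K p k g * x) = mu K (p ^ k) g (exp x))

include hlam hexp in
/-- **`G_ℚ`-compatibility of the residual local cup product for EVERY conjugation datum** (Howard's «`G_ℚ`-invariant
local Tate pairing», Lemma 1.5.3; the letter `hGQ` of `InertLocalPairingInvarianceProofs` /
`EigenSelmerDichotomyProofs.localCup_transportH1_cast_eq_zero_of_eq_of_eq_neg_of_readings` at EVERY finite place `v`,
for every residual duality datum `D̄` with H.5(c)-letter `hθ`, every reading `(λ, exp)` and every `σ`-compatible family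
of invariants): for `x, y ∈ H¹(K_{σ v}, T̄)` and `τ_v := θ_* ∘ transport_v : H¹(K_{σ v}, T̄) → H¹(K_v, T̄)`,
`inv_v (H²(exp λ)(τ_v x ∪_P τ_v y)) = inv_{σ v} (H²(exp λ)(x ∪_P y))`.
PROOF: `transport_v` of `cd` IS `transport_v` of the canonical datum `ofLifts cd.σ … cd.τ …` (§2); `D̄` and `A` ARE data
over that datum (their axioms mention the datum only through `conj`, which is the same); `τ` inverts `μ_{p^k}` (§3);
then w5 g8's `inv_cohomologyMap_cupProduct_thetaH1_transportH1_ofLifts` (σ_* transports cup products and THE invariant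
maps are `σ`-compatible, Cassels–Fröhlich VI §1.1).
[cite: Howard2004HeegnerKolyvagin, Lemma 1.5.3 (arXiv:1202.6340 p. 10 L10–12: «the `G_ℚ`-invariant local Tate pairing») and §1.3, Rem. 1.3.2 (p. 7 L44–48, p. 8 L13–17)]
[cite: CasselsFrohlichANT1967, Ch. VI §1.1 (functoriality of `inv`)] [cite: SerreLocalFields1979, VII §5 Prop. 3] -/
theorem inv_cohomologyMap_cupProduct_thetaH1_transportH1 [Finite Nbar]
    (hθ : ∀ x y : Nbar, Dbar.e (A.θ x) (A.θ y) = -Dbar.e x y)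
    (inv : LocalInvariants K (p ^ k)) (hinv : inv.IsConjCompatible cd.σ)
    (v : HeightOneSpectrum (𝓞 K)) (hv : cd.σ • (cd.σ • v) = v)
    (x y : galoisCohomology (ρbar.toLocal (Sum.inr (cd.σ • v))) 1) :
    inv (Sum.inr v) (cohomologyMap (Dbar.expLamLocalHom lam hlam exp hexp (Sum.inr v)) 2
      (haveI : CompactSpace (absoluteGaloisGroup (Place.Completion (Sum.inr v : Place K))) :=
          absoluteGaloisGroup_compactSpace _;
        (DiscreteGaloisModule.pairing (ρbar.toLocal (Sum.inr v)) (ρbar.toLocal (Sum.inr v))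
            (Dbar.twistOne.toLocal (Sum.inr v)) (Dbar.eHom.compl₂ A.θ.toAddMonoidHom)
            (Dbar.thetaPairing_equivariant_toLocal A (Sum.inr v))).cupProduct
          (A.thetaH1 (Sum.inr v) (cd.transportH1 ρbar v x))
          (A.thetaH1 (Sum.inr v) (cd.transportH1 ρbar v y)))) =
    inv (Sum.inr (cd.σ • v))
      (cohomologyMap (Dbar.expLamLocalHom lam hlam exp hexp (Sum.inr (cd.σ • v))) 2
        (haveI : CompactSpace (absoluteGaloisGroup (Place.Completion (Sum.inr (cd.σ • v) : Place K))) :=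
          absoluteGaloisGroup_compactSpace _;
        (DiscreteGaloisModule.pairing (ρbar.toLocal (Sum.inr (cd.σ • v))) (ρbar.toLocal (Sum.inr (cd.σ • v)))
            (Dbar.twistOne.toLocal (Sum.inr (cd.σ • v))) (Dbar.eHom.compl₂ A.θ.toAddMonoidHom)
            (Dbar.thetaPairing_equivariant_toLocal A (Sum.inr (cd.σ • v)))).cupProduct x y)) := by
  have hp : p.Prime := Fact.out
  -- the same data over the canonical datum `ofLifts cd.σ … cd.τ …` (field by field; the axioms only mention `conj`)
  let Dbar' : DualityDatum p
      (ConjugationDatum.ofLifts cd.σ cd.σ_ne_one cd.sigma_mul_sigma_eq_one cd.τ cd.isLift cd.involutive) ρbar R :=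
    ⟨Dbar.e, Dbar.symm, Dbar.perfect, Dbar.equivariant, Dbar.twistOne, Dbar.twistOne_apply⟩
  let A' : ResidualTau (R := R)
      (ConjugationDatum.ofLifts cd.σ cd.σ_ne_one cd.sigma_mul_sigma_eq_one cd.τ cd.isLift cd.involutive) ρbar :=
    ⟨A.θ, A.involutive, A.compat⟩
  have hτμ : ∀ ζ : MuCarrier K (p ^ k), muSemilinearMap cd.τ (p ^ k) ζ = -ζ :=
    fun ζ => cd.muSemilinearMap_τ_eq_neg (pow_ne_zero k hp.ne_zero) ζ
  rw [cd.transportH1_apply_eq_ofLifts ρbar v x, cd.transportH1_apply_eq_ofLifts ρbar v y]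
  exact Dbar'.inv_cohomologyMap_cupProduct_thetaH1_transportH1_ofLifts A' lam hlam exp hexp hθ hτμ inv hinv v hv x y

end DualityDatum

end Literature.NumberTheory.GaloisCohomology.Howard2004

end
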